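import Literature.RingTheory.MvPolynomial.DegreeOfTruncation
import Literature.Computability.AlgebraicComplexity.UABPToolkit
import Literature.Computability.AlgebraicComplexity.DDS21TraceBackFinalStep
import Mathlib.Algebra.Ring.GeomSum
import HarnessLib

/-!
# Dutta–Dwivedi–Saxena 2021, Thm. 3.2 at `k = 2`: the TRACE-BACK (ABP side) from the Wronskian
# congruence

Topic `Literature/Computability/AlgebraicComplexity`; cell `val-lit`, row X2-DDS21 (lead-np RULING (118)(1),
p2 g10 CLAIM 18:40Z); a PROOFS file: theorems only, no definitions, no named facts. Source: P. Dutta,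
P. Dwivedi, N. Saxena, *Demystifying the border of depth-3 algebraic circuits*, FOCS 2021
[DuttaDwivediSaxena2022], full version `paper:galaxy-pdf-7641649743695546420`, §3 proof of Thm. 3.2
("`k = 2` is already non-trivial", p0026 L717; divide and derive p0028 L763 – p0029 L767; trace back
p0034 L906 – p0035 L931); detailed `k = 2` write-up in the survey Dutta–Lysikov 2025 §4.4.1.

## What is proved

The `ε`-side of the `k = 2` case (t19 g11, `DDS21TopFaninTwoNormalForm.lean` + the announced
`DDS21TopFaninTwoDiDIL.lean`) ends with a WRONSKIAN CONGRUENCE over `F` in the frame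
`z = x_0` of `F[x_0, …, x_n]`, `Φ : x_i ↦ z x_i + α_i` (`aeval (fun i => X 0 * X i.succ + C (α i))`):
`(∂_z G)·W − G·(∂_z W) ≡ R (mod z^N)` with `G = Φ(f)`, `W = Φ(t₂)` for a product of affine forms
`t₂` with `t₂(α) ≠ 0`, and an explicit `R` computed by an ABP. This file is the ABP side, with `R`
ABSTRACT (any polynomial with an ABP):

* §1 **Truncated inverses and the Wronskian integration** (pure algebra over a field of
  characteristic zero, in the `truncDegreeOf` calculus of
  `Literature/RingTheory/MvPolynomial/DegreeOfTruncation.lean`, t18 g10): for `W` with `z`-free part a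
  nonzero constant `κ`, the truncated geometric series `V = κ⁻¹ Σ_{r ≤ N} (1 − κ⁻¹ W)^r` inverts `W`
  modulo `z^{N+1}` (`truncDegreeOf_mul_invSeries`); the quotient rule
  `∂_z(G V) ≡ V²·((∂_z G) W − G (∂_z W))` (`truncDegreeOf_pderiv_mul_invSeries`); hence from the
  Wronskian congruence, by "integrate and add the `z = 0` value"
  (`truncDegreeOf_succ_eq_of_pderiv_congr`),
  `G ≡ (g₀ κ⁻¹ + ∫_N (V² R)) · W (mod z^{N+1})` (`truncDegreeOf_eq_of_wronskian_congr`).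
* §2 **The ABP side of DDS Thm. 3.2 at `k = 2`** (`uabpComputes_of_wronskian_congr`): with
  `G = Φ(f)`, `W = Φ(t₂)`, `t₂ ∈ ΠΣ` (`spsClass F n 1 d`), `t₂(α) ≠ 0`, `N + 1 > deg f` and
  `UABPComputes S R`, the polynomial `f` is computed by a univariate-labelled layered ABP within
  budget `100 · s^5` for every `s` above explicit polynomial thresholds — the numerator
  `(g₀ κ⁻¹ + ∫_N (V² R)) · W` has an ABP by the toolkit (`aeval_phi`, `geom_sum`,
  `integrateDegreeOf`, `mul`, `add`), and t18 g10's landed last step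
  `uabpComputes_of_phi_truncDegreeOf_eq` (`DDS21TraceBackFinalStep.lean`, division-free here:
  denominator `1`) removes `Φ`.
* §3 `uabpComputes_of_wronskian_congr_pow`: the same with ONE power budget `s ^ 182` for every
  `s ≥ 2` dominating `d, N, S, S₂` (the idiom of the named fact `DDS2021_thm_3_2`).

The unconditional `\overline{Σ^{[2]}Π^{[d]}Σ} ⊆ ABP` (= `DDS2021_thm_3_2` at `k = 2`) is then ONE
`obtain` from the `ε`-side's Wronskian congruence with its explicit `R`; it is NOT claimed here.
Honest framing: bookkeeping toward a published 2021 upper bound; nothing here bears on VP versus VNP,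
which is NOT proved; `DDS2021_thm_3_2` stays a named fact.

## References

* [DuttaDwivediSaxena2022] P. Dutta, P. Dwivedi, N. Saxena, *Demystifying the border of depth-3
  algebraic circuits*, Proc. 62nd FOCS (2021), IEEE 2022, 92–103; full version
  `paper:galaxy-pdf-7641649743695546420`: §3, Thm. 3.2 and its proof (p0026 L710–717, p0028 L751–765,
  p0029 L766–785, p0034 L906 – p0035 L931, p0036 L957–961).
-/

noncomputable section

open MvPolynomial Literature.RingTheory.MvPolynomial
open scoped BigOperators

namespace Literature.Computability.AlgebraicComplexity

namespace DDS2021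

/-! ### §1 Truncated inverses and the Wronskian integration -/

section Algebra

variable {F : Type*} [Field F] {σ : Type*} [DecidableEq σ]

/-- Truncation modulo `x_i^1` is the `x_i`-free slice. [cite: DuttaDwivediSaxena2022, §3 proof of Thm. 3.2 (full version p0028 L755)] -/
theorem truncDegreeOf_one_eq (i : σ) (p : MvPolynomial σ F) :
    truncDegreeOf i 1 p = weightedHomogeneousComponent (Pi.single i 1) 0 p := by
  rw [truncDegreeOf_apply, Finset.sum_range_one]

/-- If the `x_i`-free slice of `Y` vanishes then `Y^k ≡ 0 (mod x_i^k)` (every monomial of `Y^k` has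
`x_i`-degree `≥ k`). [cite: DuttaDwivediSaxena2022, §3 proof of Thm. 3.2, Claim 3.7 (full version p0034 L906–913)] -/
theorem truncDegreeOf_pow_eq_zero_of_truncDegreeOf_one {i : σ} {Y : MvPolynomial σ F}
    (hY : truncDegreeOf i 1 Y = 0) (k : ℕ) : truncDegreeOf i k (Y ^ k) = 0 := by
  have hsupp : ∀ d ∈ Y.support, 1 ≤ d i := by
    intro d hd
    by_contra hlt
    push Not at hlt
    have h := congrArg (coeff d) hY
    rw [coeff_truncDegreeOf, if_pos hlt, coeff_zero] at h
    exact (mem_support_iff.1 hd) h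
  induction k with
  | zero => rw [truncDegreeOf_zero_right]
  | succ k ih =>
    have h := truncDegreeOf_mul_congr_of_le (i := i) (a := k) (v := 1) (p := Y ^ k) (q := 0)
      (r := Y) (by rw [ih, map_zero]) hsupp
    rw [mul_zero, map_zero] at h
    rw [pow_succ', h]

/-- **The truncated geometric series inverts a polynomial with nonzero constant `x_i`-free part**:
if `W ≡ κ (mod x_i)`, `κ ≠ 0`, then `W · (κ⁻¹ Σ_{r<N} (1 − κ⁻¹ W)^r) ≡ 1 (mod x_i^N)` ("the inverse
identity `1/(1−z) ≡ 1 + … + z^{D−1} mod z^D`", Claim 3.7 / Lemma 2.6).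
[cite: DuttaDwivediSaxena2022, §3 proof of Thm. 3.2, Claim 3.7 (full version p0034 L906–913)] -/
theorem truncDegreeOf_mul_invSeries {i : σ} {W : MvPolynomial σ F} {κ : F} (hκ : κ ≠ 0)
    (hW : truncDegreeOf i 1 W = C κ) (N : ℕ) :
    truncDegreeOf i N (W * (C κ⁻¹ * ∑ r ∈ Finset.range N, (1 - C κ⁻¹ * W) ^ r)) =
      truncDegreeOf i N 1 := by
  set Y : MvPolynomial σ F := 1 - C κ⁻¹ * W with hY
  have hY0 : truncDegreeOf i 1 Y = 0 := by
    rw [hY, map_sub, ← smul_eq_C_mul, LinearMap.map_smul, hW, smul_eq_C_mul, ← C_mul,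
      inv_mul_cancel₀ hκ, C_1, truncDegreeOf_eq_self (by rw [← C_1, degreeOf_C]; exact Nat.zero_lt_one),
      sub_self]
  have hWY : W * (C κ⁻¹ * ∑ r ∈ Finset.range N, Y ^ r) = 1 - Y ^ N := by
    rw [← mul_neg_geom_sum Y N, hY]
    ring
  rw [hWY, map_sub, truncDegreeOf_pow_eq_zero_of_truncDegreeOf_one hY0 N, sub_zero]

/-- The `x_i`-free slice of the truncated inverse is `κ⁻¹`. [cite: DuttaDwivediSaxena2022, §3 proof of Thm. 3.2, Claim 3.7 (full version p0034 L906–913)] -/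
theorem truncDegreeOf_one_invSeries {i : σ} {W : MvPolynomial σ F} {κ : F} (hκ : κ ≠ 0)
    (hW : truncDegreeOf i 1 W = C κ) (N : ℕ) (hN : 1 ≤ N) :
    truncDegreeOf i 1 (C κ⁻¹ * ∑ r ∈ Finset.range N, (1 - C κ⁻¹ * W) ^ r) = C κ⁻¹ := by
  set Y : MvPolynomial σ F := 1 - C κ⁻¹ * W with hY
  have hY0 : truncDegreeOf i 1 Y = 0 := by
    rw [hY, map_sub, ← smul_eq_C_mul, LinearMap.map_smul, hW, smul_eq_C_mul, ← C_mul,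
      inv_mul_cancel₀ hκ, C_1, truncDegreeOf_eq_self (by rw [← C_1, degreeOf_C]; exact Nat.zero_lt_one),
      sub_self]
  have hpow : ∀ r ∈ Finset.range N, truncDegreeOf i 1 (Y ^ r) = if r = 0 then 1 else 0 := by
    intro r _
    rcases Nat.eq_zero_or_pos r with rfl | hr
    · rw [pow_zero, if_pos rfl]
      exact truncDegreeOf_eq_self (by rw [← C_1, degreeOf_C]; exact Nat.zero_lt_one)
    · rw [if_neg hr.ne']
      have h := truncDegreeOf_pow_eq_zero_of_truncDegreeOf_one hY0 r
      have hmono := truncDegreeOf_congr_mono (i := i) (D := r) (D' := 1) hr (p := Y ^ r) (q := 0)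
        (by rw [h, map_zero])
      rwa [map_zero] at hmono
  rw [← smul_eq_C_mul, LinearMap.map_smul, map_sum, Finset.sum_congr rfl hpow,
    Finset.sum_ite_eq' (Finset.range N) 0 (fun _ => (1 : MvPolynomial σ F)),
    if_pos (Finset.mem_range.2 hN), smul_eq_C_mul, mul_one]

/-- **The quotient rule under truncation**: if `W V ≡ 1 (mod x_i^{N+1})` then
`∂_i (G V) ≡ V² · ((∂_i G) W − G (∂_i W)) (mod x_i^N)` — the Wronskian appears because
`∂_i V ≡ −V² ∂_i W`. [cite: DuttaDwivediSaxena2022, §3 proof of Thm. 3.2, "Divide and derive" (full version p0028 L763 – p0029 L767)] -/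
theorem truncDegreeOf_pderiv_mul_of_inv {i : σ} {N : ℕ} {G W V : MvPolynomial σ F}
    (hWV : truncDegreeOf i (N + 1) (W * V) = truncDegreeOf i (N + 1) 1) :
    truncDegreeOf i N (pderiv i (G * V)) =
      truncDegreeOf i N (V ^ 2 * (pderiv i G * W - G * pderiv i W)) := by
  -- `W V ≡ 1 (mod x_i^N)` and `W' V + W V' ≡ 0 (mod x_i^N)`
  have hWV' : truncDegreeOf i N (W * V) = truncDegreeOf i N 1 :=
    truncDegreeOf_congr_mono (Nat.le_succ N) hWV
  have hder : truncDegreeOf i N (pderiv i W * V + W * pderiv i V) = truncDegreeOf i N 0 := by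
    have h := truncDegreeOf_pderiv_congr hWV
    rw [Derivation.leibniz, smul_eq_mul, smul_eq_mul, Derivation.map_one_eq_zero] at h
    have hcomm : pderiv i W * V + W * pderiv i V = W * pderiv i V + V * pderiv i W := by ring
    rw [hcomm]
    exact h
  -- `G' V ≡ V² G' W`
  have h1 : truncDegreeOf i N (pderiv i G * V) = truncDegreeOf i N (V ^ 2 * (pderiv i G * W)) := by
    have h := truncDegreeOf_mul_congr (i := i) (D := N) (p := pderiv i G * V) (p' := pderiv i G * V)
      rfl hWV'
    rw [mul_one] at h
    rw [← h]
    congr 1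
    ring
  -- `G V' ≡ - V² G W'`
  have h2 : truncDegreeOf i N (G * pderiv i V) = truncDegreeOf i N (-(V ^ 2 * (G * pderiv i W))) := by
    -- `G V' = G V' · 1 ≡ G V' (W V) = (G V) (W V')` and `W V' ≡ - W' V`
    have h3 : truncDegreeOf i N (G * pderiv i V) = truncDegreeOf i N (G * V * (W * pderiv i V)) := by
      have h := truncDegreeOf_mul_congr (i := i) (D := N) (p := G * pderiv i V) (p' := G * pderiv i V)
        rfl hWV'
      rw [mul_one] at h
      rw [← h]
      congr 1
      ring
    have h4 : truncDegreeOf i N (W * pderiv i V) = truncDegreeOf i N (-(pderiv i W * V)) := by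
      rw [map_neg, eq_neg_iff_add_eq_zero, ← map_add, add_comm, hder, map_zero]
    have h5 := truncDegreeOf_mul_congr (i := i) (D := N) (p := G * V) (p' := G * V) rfl h4
    rw [h3, h5]
    congr 1
    ring
  rw [Derivation.leibniz, smul_eq_mul, smul_eq_mul, map_add, mul_comm V (pderiv i G), h1, h2,
    ← map_add]
  congr 1
  ring

variable [CharZero F]

/-- **Trace-back from a Wronskian congruence** (the `k = 2` case of the DiDIL trace-back, p0034
L906 – p0035 L931, in one step): if `W ≡ κ ≠ 0` and `G ≡ g₀` modulo `x_i`, and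
`(∂_i G) W − G (∂_i W) ≡ R (mod x_i^N)`, then with the truncated inverse
`V = κ⁻¹ Σ_{r ≤ N} (1 − κ⁻¹ W)^r` of `W`:
`G ≡ (g₀ κ⁻¹ + ∫_N (V² R)) · W (mod x_i^{N+1})` ("integrate … add the `z = 0` value … multiply by
`t` and truncate"). [cite: DuttaDwivediSaxena2022, §3 proof of Thm. 3.2, Claims 3.7–3.8 (full version p0034 L906 – p0035 L931)] -/
theorem truncDegreeOf_eq_of_wronskian_congr {i : σ} {N : ℕ} {G W R : MvPolynomial σ F} {κ g₀ : F}
    (hκ : κ ≠ 0) (hW : truncDegreeOf i 1 W = C κ) (hG : truncDegreeOf i 1 G = C g₀)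
    (hP : truncDegreeOf i N (pderiv i G * W - G * pderiv i W) = truncDegreeOf i N R) :
    truncDegreeOf i (N + 1) G =
      truncDegreeOf i (N + 1)
        ((C (g₀ * κ⁻¹) +
            integrateDegreeOf i N
              ((C κ⁻¹ * ∑ r ∈ Finset.range (N + 1), (1 - C κ⁻¹ * W) ^ r) ^ 2 * R)) * W) := by
  set V : MvPolynomial σ F := C κ⁻¹ * ∑ r ∈ Finset.range (N + 1), (1 - C κ⁻¹ * W) ^ r with hV
  have hWV : truncDegreeOf i (N + 1) (W * V) = truncDegreeOf i (N + 1) 1 :=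
    truncDegreeOf_mul_invSeries hκ hW (N + 1)
  -- `∂_i (G V) ≡ V² R (mod x_i^N)`
  have hder : truncDegreeOf i N (pderiv i (G * V)) = truncDegreeOf i N (V ^ 2 * R) := by
    rw [truncDegreeOf_pderiv_mul_of_inv hWV]
    exact truncDegreeOf_mul_congr rfl hP
  -- integrate and add the `x_i = 0` value
  have hint := truncDegreeOf_succ_eq_of_pderiv_congr hder
  have hGV0 : weightedHomogeneousComponent (Pi.single i 1) 0 (G * V) = C (g₀ * κ⁻¹) := by
    rw [← truncDegreeOf_one_eq, truncDegreeOf_mul, hG, truncDegreeOf_one_invSeries hκ hW (N + 1)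
      (Nat.succ_pos N), ← C_mul]
    exact truncDegreeOf_eq_self (by rw [degreeOf_C]; exact Nat.zero_lt_one)
  rw [hGV0] at hint
  -- multiply back by `W`: `G ≡ G (V W) = (G V) W`
  have hGVW : truncDegreeOf i (N + 1) G = truncDegreeOf i (N + 1) (G * V * W) := by
    have h := truncDegreeOf_mul_congr (i := i) (D := N + 1) (p := G) (p' := G) rfl hWV
    rw [mul_one] at h
    rw [← h]
    congr 1
    ring
  have hint' : truncDegreeOf i (N + 1) (G * V) =
      truncDegreeOf i (N + 1) (C (g₀ * κ⁻¹) + integrateDegreeOf i N (V ^ 2 * R)) := by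
    rw [← hint, truncDegreeOf_truncDegreeOf, min_self]
  rw [hGVW]
  exact truncDegreeOf_mul_congr hint' rfl

end Algebra

/-! ### §2 The ABP side of DDS Thm. 3.2 at `k = 2` -/

section ABP

variable {F : Type*} [Field F] {n : ℕ}

/-- A `Σ^{[k]}Π^{[d]}Σ` polynomial (a sum of products of `d` affine forms) has total degree `≤ d`.
[cite: DuttaDwivediSaxena2022, §1.1 (full version p0006 L120–121)] -/
theorem totalDegree_le_of_mem_spsClass {k d : ℕ} {t : MvPolynomial (Fin n) F}
    (ht : t ∈ spsClass F n k d) : t.totalDegree ≤ d := by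
  obtain ⟨α, rfl⟩ := ht
  refine totalDegree_finsetSum_le fun i _ => (totalDegree_finsetProd _ _).trans ?_
  calc ∑ j : Fin d, (C (α i j none) + ∑ m : Fin n, C (α i j (some m)) * X m :
          MvPolynomial (Fin n) F).totalDegree ≤ ∑ _j : Fin d, 1 := by
        refine Finset.sum_le_sum fun j _ => (totalDegree_add _ _).trans (max_le ?_ ?_)
        · rw [totalDegree_C]; exact Nat.zero_le _
        · refine totalDegree_finsetSum_le fun m _ => ?_
          refine (totalDegree_mul _ _).trans ?_
          rw [totalDegree_C, totalDegree_X, zero_add]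
    _ = d := by simp

/-- **`Φ(p)` at `z = 0` is the constant `p(α)`**: `Φ(p) ≡ p(α) (mod x_0)` for the DiDIL map
`Φ : x_i ↦ z x_i + α_i` ("`Φ(T_{i,0})|_{x=0} = T_{i,0}(α)`", p0028 L753–754; here read modulo `z`).
(The tree's public version is `DDS2021.truncDegreeOf_one_aeval_phi` of `DDS21TraceBackStep.lean`,
t24 g13, landed minutes before this file; a private copy keeps the import cone small.)
[cite: DuttaDwivediSaxena2022, §3 proof of Thm. 3.2, "Φ homomorphism" (full version p0028 L751–754)] -/
private theorem truncDegreeOf_one_aeval_phi' (α : Fin n → F) (p : MvPolynomial (Fin n) F) :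
    truncDegreeOf 0 1
        (aeval (fun i : Fin n => (X 0 * X i.succ + C (α i) : MvPolynomial (Fin (n + 1)) F)) p) =
      C (eval α p) := by
  classical
  have hC : ∀ c : F, truncDegreeOf (0 : Fin (n + 1)) 1 (C c : MvPolynomial (Fin (n + 1)) F) = C c :=
    fun c => truncDegreeOf_eq_self (by rw [degreeOf_C]; exact Nat.zero_lt_one)
  induction p using MvPolynomial.induction_on with
  | C c => rw [aeval_C, algebraMap_eq, eval_C, hC]
  | add p q hp hq => rw [map_add, map_add, map_add, C_add, hp, hq]
  | mul_X p j hp =>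
    have hX : truncDegreeOf (0 : Fin (n + 1)) 1
        (X 0 * X j.succ + C (α j) : MvPolynomial (Fin (n + 1)) F) = C (α j) := by
      have h0 := truncDegreeOf_X_pow_mul (R := F) (0 : Fin (n + 1)) 0 1 (X j.succ)
      rw [pow_one, truncDegreeOf_zero_right, mul_zero, zero_add] at h0
      rw [map_add, h0, zero_add, hC]
    simp only [map_mul, aeval_X, eval_X]
    rw [truncDegreeOf_mul, hp, hX, ← C_mul, hC]

variable [CharZero F]

/-- **DDS Thm. 3.2 at `k = 2`, the ABP side.** In the frame `z = x_0`, `Φ : x_i ↦ z x_i + α_i`: let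
`t₂` (in the application a `ΠΣ` product: `uabpComputes_of_mem_spsClass`,
`totalDegree_le_of_mem_spsClass`) have an ABP within budget `S₂`, degree `≤ d` and
`t₂(α) ≠ 0` (so `Φ(t₂) ≡ t₂(α)` and `Φ(f) ≡ f(α) (mod z)`), and
suppose the
WRONSKIAN CONGRUENCE `(∂_z Φf)·Φt₂ − Φf·(∂_z Φt₂) ≡ R (mod z^N)` for a polynomial `R` computed by an
ABP within budget `S`, with `N + 1 > deg f`. Then `f` is computed by a univariate-labelled layered
ABP within budget `100 · s^5` for every `s` dominating the explicit polynomial thresholds below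
(numerator `(f(α) t₂(α)⁻¹ + ∫_N (V² R)) · Φt₂` by `truncDegreeOf_eq_of_wronskian_congr` and the toolkit;
`Φ` removed by `uabpComputes_of_phi_truncDegreeOf_eq` with denominator `1`). The `ε`-side (the
congruence with its explicit `R` from a border `Σ^{[2]}ΠΣ` circuit) is NOT part of this file.
[cite: DuttaDwivediSaxena2022, Thm. 3.2 at k = 2 and §3 proof (full version p0026 L710–717, p0034 L906 – p0036 L961)] -/
theorem uabpComputes_of_wronskian_congr {d N S S₂ s : ℕ} {f t₂ : MvPolynomial (Fin n) F}
    (α : Fin n → F) (ht₂ : UABPComputes S₂ t₂) (hd : t₂.totalDegree ≤ d) (hα : eval α t₂ ≠ 0)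
    {R : MvPolynomial (Fin (n + 1)) F} (hR : UABPComputes S R)
    (hP : truncDegreeOf 0 N
        (pderiv 0 (aeval (fun i : Fin n => (X 0 * X i.succ + C (α i) : MvPolynomial (Fin (n + 1)) F)) f) *
            aeval (fun i : Fin n => (X 0 * X i.succ + C (α i) : MvPolynomial (Fin (n + 1)) F)) t₂ -
          aeval (fun i : Fin n => (X 0 * X i.succ + C (α i) : MvPolynomial (Fin (n + 1)) F)) f *
            pderiv 0 (aeval (fun i : Fin n => (X 0 * X i.succ + C (α i) : MvPolynomial (Fin (n + 1)) F)) t₂)) =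
      truncDegreeOf 0 N R)
    (hdeg : f.totalDegree < N + 1) (hs : 2 ≤ s) (h3 : 2 * (N + 1) ≤ s)
    (h1 : (N + 1) * ((4 * (2 + (N * (2 + (((N + 1) * ((2 + N * (4 * (2 + (((d + 1) * (d + 2 + S₂ * (d + 1)) + 2) + 2)) + 2)) + (2 + N * (4 * (2 + (((d + 1) * (d + 2 + S₂ * (d + 1)) + 2) + 2)) + 2))) + 2 + 2) + ((N + 1) * ((2 + N * (4 * (2 + (((d + 1) * (d + 2 + S₂ * (d + 1)) + 2) + 2)) + 2)) + (2 + N * (4 * (2 + (((d + 1) * (d + 2 + S₂ * (d + 1)) + 2) + 2)) + 2))) + 2 + 2) + S) * N) + 2)) + 2 + ((d + 1) * (d + 2 + S₂ * (d + 1)) + 2)) * (N + 1)) + 2 ≤ s) :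
    UABPComputes (100 * s ^ 5) f := by
  classical
  set Φ : MvPolynomial (Fin n) F →ₐ[F] MvPolynomial (Fin (n + 1)) F :=
    aeval (fun i : Fin n => (X 0 * X i.succ + C (α i) : MvPolynomial (Fin (n + 1)) F)) with hΦ
  set W := Φ t₂ with hWdef
  set G := Φ f with hGdef
  set κ : F := eval α t₂ with hκdef
  set g₀ : F := eval α f with hg₀def
  have hW : truncDegreeOf 0 1 W = C κ := truncDegreeOf_one_aeval_phi' α t₂
  have hG : truncDegreeOf 0 1 G = C g₀ := truncDegreeOf_one_aeval_phi' α f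
  set Y : MvPolynomial (Fin (n + 1)) F := 1 - C κ⁻¹ * W with hY
  set V : MvPolynomial (Fin (n + 1)) F := C κ⁻¹ * ∑ r ∈ Finset.range (N + 1), Y ^ r with hV
  set M : MvPolynomial (Fin (n + 1)) F := C (g₀ * κ⁻¹) + integrateDegreeOf 0 N (V ^ 2 * R) with hM
  -- the algebra: `Φ f ≡ M · W (mod z^{N+1})`
  have hcongr : truncDegreeOf 0 (N + 1) G = truncDegreeOf 0 (N + 1) (M * W) :=
    truncDegreeOf_eq_of_wronskian_congr hα hW hG hP
  -- ABPs
  have hWabp : UABPComputes ((d + 1) * (d + 2 + S₂ * (d + 1)) + 2) W := ht₂.aeval_phi hd α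
  have hC1 : UABPComputes 2 (C 1 : MvPolynomial (Fin (n + 1)) F) :=
    (UABPComputesLen.of_C le_rfl (1 : F)).uabpComputes
  have hYabp := hC1.add (hWabp.smul_C (-κ⁻¹))
  have hYeq : (C 1 : MvPolynomial (Fin (n + 1)) F) + C (-κ⁻¹) * W = Y := by
    rw [hY, map_neg, C_1]; ring
  rw [hYeq] at hYabp
  obtain ⟨LY, hYlen⟩ := hYabp.exists_len
  have hpow : ∀ r : Fin (N + 1), UABPComputes
      (2 + N * (4 * (2 + ((d + 1) * (d + 2 + S₂ * (d + 1)) + 2 + 2)) + 2))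
      (Y ^ (r : ℕ)) := fun r =>
    ((hYlen.pow (r : ℕ)).uabpComputes).mono
      (Nat.add_le_add_left (Nat.mul_le_mul_right _ (Nat.lt_succ_iff.1 r.isLt)) _)
  have hsum := UABPComputes.sum (by omega) (fun r : Fin (N + 1) => Y ^ (r : ℕ)) hpow
  rw [Fin.sum_univ_eq_sum_range (fun r => Y ^ r) (N + 1), Fintype.card_fin] at hsum
  have hVabp := hsum.smul_C κ⁻¹
  have hV2 := hVabp.mul hVabp
  rw [← sq] at hV2
  have hI := (hV2.mul hR).integrateDegreeOf 0 N
  have hC0 : UABPComputes 2 (C (g₀ * κ⁻¹) : MvPolynomial (Fin (n + 1)) F) :=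
    (UABPComputesLen.of_C le_rfl _).uabpComputes
  have hMabp := hC0.add hI
  have hNum := hMabp.mul hWabp
  -- the final step (t18): denominator `1`
  have hden : UABPComputes 2 (1 : MvPolynomial (Fin n) F) := by
    rw [← C_1]; exact (UABPComputesLen.of_C le_rfl (1 : F)).uabpComputes
  refine uabpComputes_of_phi_truncDegreeOf_eq α hNum hden one_ne_zero ?_ hdeg hs h1 (by omega) h3
  rw [map_one, one_mul]
  exact hcongr

end ABP

/-! ### §3 The same with power-of-`s` budgets (the idiom of `DDS2021_thm_3_2`) -/

section Pow

/-- `a + b ≤ s^{i+1}` from `a, b ≤ s^i` (`s ≥ 2`). [folklore] -/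
private theorem padd {s i a b : ℕ} (hs : 2 ≤ s) (ha : a ≤ s ^ i) (hb : b ≤ s ^ i) :
    a + b ≤ s ^ (i + 1) := by
  rw [pow_succ]; nlinarith

/-- `a * b ≤ s^{i+j}` from `a ≤ s^i`, `b ≤ s^j`. [folklore] -/
private theorem pmul {s i j a b : ℕ} (ha : a ≤ s ^ i) (hb : b ≤ s ^ j) : a * b ≤ s ^ (i + j) := by
  rw [pow_add]; exact Nat.mul_le_mul ha hb

/-- Raising the exponent. [folklore] -/
private theorem pmono {s i j a : ℕ} (hs : 2 ≤ s) (hij : i ≤ j) (ha : a ≤ s ^ i) : a ≤ s ^ j :=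
  ha.trans (Nat.pow_le_pow_right (by omega) hij)

/-- Constants: `a ≤ 2^t ≤ s^t`. [folklore] -/
private theorem pconst {s t a : ℕ} (hs : 2 ≤ s) (ha : a ≤ 2 ^ t) : a ≤ s ^ t :=
  ha.trans (Nat.pow_le_pow_left hs t)

variable {F : Type*} [Field F] [CharZero F] {n : ℕ}

/-- **DDS Thm. 3.2 at `k = 2`, the ABP side, with a power budget**: as
`uabpComputes_of_wronskian_congr`, for every `s ≥ 2` dominating `d`, `N`, `S`, `S₂` the budget is
`s ^ 182` (one absolute exponent, the idiom of `DDS2021_thm_3_2`).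
[cite: DuttaDwivediSaxena2022, Thm. 3.2 at k = 2 and §3 proof (full version p0026 L710–717, p0034 L906 – p0036 L961)] -/
theorem uabpComputes_of_wronskian_congr_pow {d N S S₂ s : ℕ} {f t₂ : MvPolynomial (Fin n) F}
    (α : Fin n → F) (ht₂ : UABPComputes S₂ t₂) (hd : t₂.totalDegree ≤ d) (hα : eval α t₂ ≠ 0)
    {R : MvPolynomial (Fin (n + 1)) F} (hR : UABPComputes S R)
    (hP : truncDegreeOf 0 N
        (pderiv 0 (aeval (fun i : Fin n => (X 0 * X i.succ + C (α i) : MvPolynomial (Fin (n + 1)) F)) f) *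
            aeval (fun i : Fin n => (X 0 * X i.succ + C (α i) : MvPolynomial (Fin (n + 1)) F)) t₂ -
          aeval (fun i : Fin n => (X 0 * X i.succ + C (α i) : MvPolynomial (Fin (n + 1)) F)) f *
            pderiv 0 (aeval (fun i : Fin n => (X 0 * X i.succ + C (α i) : MvPolynomial (Fin (n + 1)) F)) t₂)) =
      truncDegreeOf 0 N R)
    (hdeg : f.totalDegree < N + 1) (hs : 2 ≤ s) (hds : d ≤ s) (hNs : N ≤ s) (hSs : S ≤ s)
    (hS₂s : S₂ ≤ s) : UABPComputes (s ^ 182) f := by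
  have h1s : (1 : ℕ) ≤ s ^ 1 := Nat.one_le_pow _ _ (by omega)
  have h2s : (2 : ℕ) ≤ s ^ 1 := by rw [pow_one]; exact hs
  have h4s : (4 : ℕ) ≤ s ^ 2 := pconst hs (by norm_num)
  have hd1 : d ≤ s ^ 1 := by rw [pow_one]; exact hds
  have hN1 : N ≤ s ^ 1 := by rw [pow_one]; exact hNs
  have hS1 : S ≤ s ^ 1 := by rw [pow_one]; exact hSs
  have hS₂1 : S₂ ≤ s ^ 1 := by rw [pow_one]; exact hS₂s
  -- `A = (d + 1) * (d + 2 + S₂ * (d + 1)) + 2 ≤ s^7`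
  have hd1' : d + 1 ≤ s ^ 2 := padd hs hd1 h1s
  have hd2 : d + 2 ≤ s ^ 2 := padd hs hd1 h2s
  have hA : (d + 1) * (d + 2 + S₂ * (d + 1)) + 2 ≤ s ^ 7 :=
    padd hs (pmul hd1' (padd hs (pmono hs (by norm_num) hd2) (pmul hS₂1 hd1')))
      (pmono hs (by norm_num) h2s)
  -- `SP = 2 + N * (4 * (2 + (A + 2)) + 2) ≤ s^14`
  have hSP : 2 + N * (4 * (2 + ((d + 1) * (d + 2 + S₂ * (d + 1)) + 2 + 2)) + 2) ≤ s ^ 14 :=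
    padd hs (pmono hs (by norm_num) h2s)
      (pmul hN1 (padd hs (pmul h4s (padd hs (pmono hs (by norm_num) h2s)
        (padd hs hA (pmono hs (by norm_num) h2s)))) (pmono hs (by norm_num) h2s)))
  -- `SV = (N + 1) * (SP + SP) + 2 + 2 ≤ s^19`
  have hN1' : N + 1 ≤ s ^ 2 := padd hs hN1 h1s
  have hSV : (N + 1) * ((2 + N * (4 * (2 + ((d + 1) * (d + 2 + S₂ * (d + 1)) + 2 + 2)) + 2)) +
      (2 + N * (4 * (2 + ((d + 1) * (d + 2 + S₂ * (d + 1)) + 2 + 2)) + 2))) + 2 + 2 ≤ s ^ 19 :=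
    padd hs (padd hs (pmul hN1' (padd hs hSP hSP)) (pmono hs (by norm_num) h2s))
      (pmono hs (by norm_num) h2s)
  -- `inner = N * (2 + (SV + SV + S) * N) + 2 ≤ s^25`
  have hinner : N * (2 + (((N + 1) * ((2 + N * (4 * (2 + ((d + 1) * (d + 2 + S₂ * (d + 1)) + 2 + 2)) + 2)) +
      (2 + N * (4 * (2 + ((d + 1) * (d + 2 + S₂ * (d + 1)) + 2 + 2)) + 2))) + 2 + 2) +
      ((N + 1) * ((2 + N * (4 * (2 + ((d + 1) * (d + 2 + S₂ * (d + 1)) + 2 + 2)) + 2)) +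
      (2 + N * (4 * (2 + ((d + 1) * (d + 2 + S₂ * (d + 1)) + 2 + 2)) + 2))) + 2 + 2) + S) * N) + 2 ≤
      s ^ 25 :=
    padd hs (pmul hN1 (padd hs (pmono hs (by norm_num) h2s)
      (pmul (padd hs (padd hs hSV hSV) (pmono hs (by norm_num) hS1)) hN1)))
      (pmono hs (by norm_num) h2s)
  -- `SNum = 4 * (2 + inner) + 2 + A ≤ s^30`, `B = (N+1) * (SNum * (N+1)) + 2 ≤ s^35`
  have hSNum := padd hs (padd hs (pmul h4s (padd hs (pmono hs (by norm_num) h2s) hinner))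
    (pmono hs (by norm_num) h2s)) (pmono hs (by norm_num) hA)
  have hB := padd hs (pmul hN1' (pmul hSNum hN1')) (pmono hs (by norm_num) h2s)
  have hs35 : 2 ≤ s ^ 35 := pmono hs (by norm_num) h2s
  have h3 : 2 * (N + 1) ≤ s ^ 35 := pmono hs (by norm_num) (pmul h2s hN1')
  have key := uabpComputes_of_wronskian_congr α ht₂ hd hα hR hP hdeg hs35 h3 hB
  refine key.mono ?_
  calc 100 * (s ^ 35) ^ 5 ≤ s ^ 7 * (s ^ 35) ^ 5 :=
        Nat.mul_le_mul_right _ (pconst hs (by norm_num))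
    _ = s ^ 182 := by ring

end Pow

end DDS2021

end Literature.Computability.AlgebraicComplexity

end
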